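import Literature.AlgebraicGeometry.Modules.LocallyFreeRankLocusRepresentable
import Literature.AlgebraicGeometry.Modules.AffineLocalizingClosure
import Literature.AlgebraicGeometry.Modules.FiniteType
import Literature.AlgebraicGeometry.Morphisms.CohAffineExactness
import Mathlib.CategoryTheory.Limits.Preserves.Shapes.Kernels
import HarnessLib

/-!
# The rank loci of a morphism of quasi-coherent modules (Stacks 05P8 applied to the cokernel)

For a morphism `φ : E ⟶ F` of `𝒪_S`-modules the RANK LOCI of `φ` — «`rank φ ≥ n − k`», «`coker φ` locally free of
rank `k`», «`rank φ ≤ s` everywhere» — are the Fitting loci of its cokernel `Q := coker φ` (The Stacks Project,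
Tag 05P8: for a finite type quasi-coherent `Q` the functor «`Q_T` is locally generated by `≤ k` sections» is an
OPEN subscheme `S ∖ Z_k`, «`Q_T` locally free of rank `k`» a LOCALLY CLOSED subscheme `Z_{k−1} ∖ Z_k`), read
through the right exactness of pull-back: `(coker φ)_T = coker(φ_T)`.  ★ `Modules/LocallyFreeRankLocusRepresentable`
(B-p09 (g14)) proves 05P8 (2)(3) for any affine-localizing module of affine-finite type; this file supplies what is
needed to apply it to `Q = coker φ` and restates the loci in `φ`-currency:

* §1 (no rank hypothesis) **`IsAffineFiniteType.cokernel`** — the cokernel of a morphism of affine-localizing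
  (= quasi-coherent) modules with target of affine-finite type is of affine-finite type (`Γ(V, F) ↠ Γ(V, coker φ)` on
  affines; quasi-coherence of the cokernel itself is ★ `IsAffineLocalizing.cokernel`, `Modules/QuasicoherentAbelian`);
  the finite-locally-free special cases `isAffineLocalizing_cokernel_of_isFiniteLocallyFree`,
  `isAffineFiniteType_cokernel_of_isFiniteLocallyFree`.
* §2 **`fittingIdealSheaf_cokernel_map_pullback`** — `Fit_k(coker (g^*φ)) = Fit_k(g^*(coker φ))` (Mathlib: the
  pull-back functor is a left adjoint, `PreservesCokernel.iso`; ★ `fittingIdealSheaf_eq_of_iso`).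
* §3 the loci of `φ`: for the subfunctor `P ⊆ h_S` of the `g : T → S` with `Fit_k(coker (g^*φ)) = 𝒪_T`
  (**`exists_subfunctor_cokerRankLE`**): the translation **`mem_iff_fittingIdealSheaf_pullback_cokernel`** into the
  hypothesis `hP` of ★ `LocallyFreeRankLocusRepresentable` (so ★ `isOpenImmersion_of_rankLE` applies verbatim),
  `exists_iso_yoneda_compl_support_cokerRankLE` (represented by the open `S ∖ Z_k(coker φ)`), `range_eq_of_cokerRankLE`;
  for the sub-subfunctor `Q ⊆ P` with `Fit_j(coker (g^*φ)) = 0 (j < k)` (**`exists_subfunctor_cokerRankEq`**): the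
  translation **`mem_iff_forall_fittingIdealSheaf_pullback_cokernel`** into `hQ` (so ★ `isImmersion_of_rankEq` /
  ★ `exists_iso_yoneda_immersion_rankEq` apply verbatim); and the closed / open conditions in `φ`-currency
  (`cokerFit_eq_bot_iff_le_ker`, `cokerFit_eq_top_iff_range_subset`).

Consumer: F-DAG F-5 (5d) (the determinantal / flattening conditions cutting `Hilb` out of `Grass` are rank
conditions on morphisms of finite locally free modules). Count-neutral Mathlib-side capital of cell
`hodgecm-mathlib`; HC_CM is proved only modulo the 7 printed citations until rung 0 closes.  Everything is proved;
theorems only (no definitions, instances, facts, notation).  The minors formula `Fit_k(coker φ)|_V = I_{n−k}(matrix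
of φ|_V)` on a framed affine `V` (★ `FittingIdeal.fittingIdeal_eq_relMinorIdeal`) is not restated here.

## References

* The Stacks Project, Tags 05P8, 0C3C, 0C3D (Divisors § 31.9), 01LA (cokernels of quasi-coherent modules).
  [StacksProject]
* R. Hartshorne, *Algebraic Geometry*, GTM 52 (1977), II Prop. 5.6 (p. 113), Prop. 5.7 (p. 114). [Hartshorne1977]
-/

noncomputable section

-- `TopCat.Presheaf`/`Scheme.Modules` are not reducible (as in Mathlib's `AlgebraicGeometry/Modules`).
set_option backward.isDefEq.respectTransparency false

open CategoryTheory CategoryTheory.Limits AlgebraicGeometry TopologicalSpace Opposite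

universe u

namespace Literature.AlgebraicGeometry.Modules

open Literature.AlgebraicGeometry.Motives Literature.AlgebraicGeometry.Morphisms

/-! ## §1 Cokernels: affine-finite type (quasi-coherence is ★ `IsAffineLocalizing.cokernel`) -/

section Cokernel

variable {X : Scheme.{u}} {E F : X.Modules} (φ : E ⟶ F)

/-- `Γ(V, F) → Γ(V, coker φ)` is surjective on every affine open `V`, for affine-localizing `E`, `F`
(the cokernel is affine-localizing, ★ `IsAffineLocalizing.cokernel`, and epimorphisms of affine-localizing modules
are onto on affines). [cite: Hartshorne1977, II Prop. 5.6 (p. 113)] -/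
theorem app_cokernel_π_surjective (hE : IsAffineLocalizing E) (hF : IsAffineLocalizing F) {V : X.Opens}
    (hV : IsAffineOpen V) : Function.Surjective ((cokernel.π φ).app V) :=
  app_surjective_of_epi (cokernel.π φ) hF (IsAffineLocalizing.cokernel φ hE hF) hV

/-- **The cokernel of a morphism of affine-localizing modules with target of affine-finite type is of
affine-finite type.** [cite: Hartshorne1977, II Prop. 5.6 (p. 113)] [cite: StacksProject, Tag 01LA] -/
theorem IsAffineFiniteType.cokernel (hE : IsAffineLocalizing E) (hF : IsAffineLocalizing F)
    (hFf : IsAffineFiniteType F) : IsAffineFiniteType (Limits.cokernel φ) :=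
  IsAffineFiniteType.of_app_surjective (cokernel.π φ) (fun _ hV => app_cokernel_π_surjective φ hE hF hV) hFf

/-- The cokernel of a morphism between finite locally free modules is affine-localizing.
[cite: StacksProject, Tag 01LA] -/
theorem isAffineLocalizing_cokernel_of_isFiniteLocallyFree (hE : IsFiniteLocallyFree E)
    (hF : IsFiniteLocallyFree F) : IsAffineLocalizing (Limits.cokernel φ) :=
  IsAffineLocalizing.cokernel φ (coh_of_isVectorBundle hE.isVectorBundle).loc
    (coh_of_isVectorBundle hF.isVectorBundle).loc

/-- The cokernel of a morphism between finite locally free modules is of affine-finite type.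
[cite: Hartshorne1977, II Prop. 5.6 (p. 113)] -/
theorem isAffineFiniteType_cokernel_of_isFiniteLocallyFree (hE : IsFiniteLocallyFree E)
    (hF : IsFiniteLocallyFree F) : IsAffineFiniteType (Limits.cokernel φ) :=
  IsAffineFiniteType.cokernel φ (coh_of_isVectorBundle hE.isVectorBundle).loc
    (coh_of_isVectorBundle hF.isVectorBundle).loc (coh_of_isVectorBundle hF.isVectorBundle).ft

end Cokernel

/-! ## §2 Pull-back: `Fit_k(coker (g^*φ)) = Fit_k(g^*(coker φ))` -/

section Pullback

variable {S : Scheme.{u}} {E F : S.Modules} (φ : E ⟶ F)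

-- `g^*` is right exact: `g^*(coker φ) ≅ coker (g^*φ)` is Mathlib's `PreservesCokernel.iso (Scheme.Modules.pullback g) φ`
-- (the pull-back functor is a left adjoint); it is used inline below.

/-- The cokernel of the pulled-back morphism `g^*φ` is affine-localizing. [cite: StacksProject, Tag 01LA] -/
theorem isAffineLocalizing_cokernel_map_pullback (hE : IsAffineLocalizing E) (hF : IsAffineLocalizing F)
    {T : Scheme.{u}} (g : T ⟶ S) : IsAffineLocalizing (cokernel ((Scheme.Modules.pullback g).map φ)) :=
  IsAffineLocalizing.cokernel _ (hE.pullback g) (hF.pullback g)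

/-- The cokernel of the pulled-back morphism `g^*φ` is of affine-finite type. [cite: StacksProject, Tag 0C3D] -/
theorem isAffineFiniteType_cokernel_map_pullback (hE : IsAffineLocalizing E) (hF : IsAffineLocalizing F)
    (hFf : IsAffineFiniteType F) {T : Scheme.{u}} (g : T ⟶ S) :
    IsAffineFiniteType (cokernel ((Scheme.Modules.pullback g).map φ)) :=
  IsAffineFiniteType.cokernel _ (hE.pullback g) (hF.pullback g) (hFf.pullback g hF)

/-- **`Fit_k(coker (g^*φ)) = Fit_k(g^*(coker φ))`**: the Fitting loci of the cokernel of `φ` base-change as the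
cokernels of the base changes of `φ`. [cite: StacksProject, Tag 0C3D] -/
theorem fittingIdealSheaf_cokernel_map_pullback (hE : IsAffineLocalizing E) (hF : IsAffineLocalizing F)
    (hFf : IsAffineFiniteType F) {T : Scheme.{u}} (g : T ⟶ S) (k : ℕ) :
    fittingIdealSheaf (cokernel ((Scheme.Modules.pullback g).map φ))
        (isAffineLocalizing_cokernel_map_pullback φ hE hF g) (isAffineFiniteType_cokernel_map_pullback φ hE hF hFf g)
        k =
      fittingIdealSheaf ((Scheme.Modules.pullback g).obj (cokernel φ))
        ((IsAffineLocalizing.cokernel φ hE hF).pullback g)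
        ((IsAffineFiniteType.cokernel φ hE hF hFf).pullback g (IsAffineLocalizing.cokernel φ hE hF)) k :=
  fittingIdealSheaf_eq_of_iso (PreservesCokernel.iso (Scheme.Modules.pullback g) φ).symm _ _ _ _ k

/-- **The closed condition «`Fit_j(coker (g^*φ)) = 0`»** in the currency of ★ `Motives/ClosedSubfunctorRepresentable`:
it holds iff the ideal sheaf `Fit_j(coker φ)` of `S` dies under `g`. [cite: StacksProject, Tag 0C3D] -/
theorem cokerFit_eq_bot_iff_le_ker (hE : IsAffineLocalizing E) (hF : IsAffineLocalizing F)
    (hFf : IsAffineFiniteType F) {T : Scheme.{u}} (g : T ⟶ S) (j : ℕ) :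
    fittingIdealSheaf (cokernel ((Scheme.Modules.pullback g).map φ))
        (isAffineLocalizing_cokernel_map_pullback φ hE hF g) (isAffineFiniteType_cokernel_map_pullback φ hE hF hFf g)
        j = ⊥ ↔
      fittingIdealSheaf (cokernel φ) (IsAffineLocalizing.cokernel φ hE hF) (IsAffineFiniteType.cokernel φ hE hF hFf)
        j ≤ g.ker := by
  rw [fittingIdealSheaf_cokernel_map_pullback φ hE hF hFf, fittingIdealSheaf_pullback_eq_bot_iff]

/-- **The open condition «`Fit_k(coker (g^*φ)) = 𝒪_T`»**: it holds iff `g` lands in the open complement of the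
support `Z_k(coker φ)`. [cite: StacksProject, Tag 0C3D] -/
theorem cokerFit_eq_top_iff_range_subset (hE : IsAffineLocalizing E) (hF : IsAffineLocalizing F)
    (hFf : IsAffineFiniteType F) {T : Scheme.{u}} (g : T ⟶ S) (k : ℕ) :
    fittingIdealSheaf (cokernel ((Scheme.Modules.pullback g).map φ))
        (isAffineLocalizing_cokernel_map_pullback φ hE hF g) (isAffineFiniteType_cokernel_map_pullback φ hE hF hFf g)
        k = ⊤ ↔
      Set.range g.base ⊆ ((fittingIdealSheaf (cokernel φ) (IsAffineLocalizing.cokernel φ hE hF)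
        (IsAffineFiniteType.cokernel φ hE hF hFf) k).support.compl : Set S) := by
  rw [fittingIdealSheaf_cokernel_map_pullback φ hE hF hFf, fittingIdealSheaf_pullback_eq_top_iff, Closeds.coe_compl]

end Pullback

/-! ## §3 The rank loci of `φ` (Stacks 05P8 (2)(3) for `coker φ`, in `φ`-currency) -/

section Loci

variable {S : Scheme.{u}} {E F : S.Modules} (φ : E ⟶ F) (hE : IsAffineLocalizing E) (hF : IsAffineLocalizing F)
  (hFf : IsAffineFiniteType F) (k : ℕ)

/-- **The subfunctor «`rank φ ≥ n − k`»**: the `g : T → S` with `Fit_k(coker (g^*φ)) = 𝒪_T` (`coker φ_T` locally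
generated by `≤ k` sections) form a subfunctor of `h_S`. [cite: StacksProject, Tag 05P8] -/
theorem exists_subfunctor_cokerRankLE :
    ∃ P : Subfunctor (yoneda.obj S), ∀ {T : Scheme.{u}} (g : T ⟶ S), g ∈ P.obj (op T) ↔
      fittingIdealSheaf (cokernel ((Scheme.Modules.pullback g).map φ))
        (isAffineLocalizing_cokernel_map_pullback φ hE hF g) (isAffineFiniteType_cokernel_map_pullback φ hE hF hFf g)
        k = ⊤ := by
  obtain ⟨P, hP⟩ := exists_subfunctor_rankLE (IsAffineLocalizing.cokernel φ hE hF)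
    (IsAffineFiniteType.cokernel φ hE hF hFf) k
  exact ⟨P, fun g => by rw [hP, fittingIdealSheaf_cokernel_map_pullback φ hE hF hFf]⟩

variable (P : Subfunctor (yoneda.obj S))
  (hP : ∀ {T : Scheme.{u}} (g : T ⟶ S), g ∈ P.obj (op T) ↔
    fittingIdealSheaf (cokernel ((Scheme.Modules.pullback g).map φ))
      (isAffineLocalizing_cokernel_map_pullback φ hE hF g) (isAffineFiniteType_cokernel_map_pullback φ hE hF hFf g)
      k = ⊤)

include hP in
/-- The membership rule of the «`rank φ ≥ n − k`» subfunctor in the currency of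
★ `LocallyFreeRankLocusRepresentable` (conditions on `g^*(coker φ)`). [cite: StacksProject, Tag 05P8] -/
theorem mem_iff_fittingIdealSheaf_pullback_cokernel {T : Scheme.{u}} (g : T ⟶ S) :
    g ∈ P.obj (op T) ↔ fittingIdealSheaf ((Scheme.Modules.pullback g).obj (cokernel φ))
      ((IsAffineLocalizing.cokernel φ hE hF).pullback g)
      ((IsAffineFiniteType.cokernel φ hE hF hFf).pullback g (IsAffineLocalizing.cokernel φ hE hF)) k = ⊤ := by
  rw [hP, fittingIdealSheaf_cokernel_map_pullback φ hE hF hFf]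

include hP in
/-- **Stacks 05P8 (2) for `coker φ`**: the subfunctor «`Fit_k(coker φ_T) = 𝒪_T`» of `h_S` is represented by the
OPEN subscheme `S ∖ Z_k(coker φ)` (precisely `S ∖ Z_k(𝟙^*(coker φ))`), compatibly with the inclusions.
[cite: StacksProject, Tag 05P8] -/
theorem exists_iso_yoneda_compl_support_cokerRankLE :
    ∃ e : yoneda.obj ((fittingIdealSheaf ((Scheme.Modules.pullback (𝟙 S)).obj (cokernel φ))
        ((IsAffineLocalizing.cokernel φ hE hF).pullback (𝟙 S))
        ((IsAffineFiniteType.cokernel φ hE hF hFf).pullback (𝟙 S) (IsAffineLocalizing.cokernel φ hE hF))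
        k).support.compl : Scheme.{u}) ≅ P.toFunctor,
      e.hom ≫ P.ι = yoneda.map (Scheme.Opens.ι _) ≫ (Iso.refl (yoneda.obj S)).hom :=
  exists_iso_yoneda_compl_support_rankLE (IsAffineLocalizing.cokernel φ hE hF) (IsAffineFiniteType.cokernel φ hE hF hFf) k P
    (fun g => mem_iff_fittingIdealSheaf_pullback_cokernel φ hE hF hFf k P hP g)

-- The classifying morphism of any representing pair of `P` is an OPEN IMMERSION: ★ `isOpenImmersion_of_rankLE`
-- applied with `hP := mem_iff_fittingIdealSheaf_pullback_cokernel φ hE hF hFf k P hP` (not restated — dedup).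

include hP in
/-- The image of the classifying morphism of the «`rank φ ≥ n − k`» subfunctor is `S ∖ Z_k(𝟙^*(coker φ))`.
[cite: StacksProject, Tag 05P8] -/
theorem range_eq_of_cokerRankLE {Y : Scheme.{u}} (e : yoneda.obj Y ≅ P.toFunctor) (g : Y ⟶ S)
    (hg : yoneda.map g ≫ (Iso.refl (yoneda.obj S)).hom = e.hom ≫ P.ι) :
    Set.range g.base = ((fittingIdealSheaf ((Scheme.Modules.pullback (𝟙 S)).obj (cokernel φ))
        ((IsAffineLocalizing.cokernel φ hE hF).pullback (𝟙 S))
        ((IsAffineFiniteType.cokernel φ hE hF hFf).pullback (𝟙 S) (IsAffineLocalizing.cokernel φ hE hF))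
        k).support.compl : Set S) :=
  range_eq_of_rankLE (IsAffineLocalizing.cokernel φ hE hF) (IsAffineFiniteType.cokernel φ hE hF hFf) k P (fun g => mem_iff_fittingIdealSheaf_pullback_cokernel φ hE hF hFf k P hP g) e g hg

variable (Q : Subfunctor P.toFunctor)
  (hQ : ∀ {T : Scheme.{u}} (g : P.toFunctor.obj (op T)), g ∈ Q.obj (op T) ↔
    ∀ j < k, fittingIdealSheaf (cokernel ((Scheme.Modules.pullback (g : T ⟶ S)).map φ))
      (isAffineLocalizing_cokernel_map_pullback φ hE hF _) (isAffineFiniteType_cokernel_map_pullback φ hE hF hFf _)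
      j = ⊥)

include hQ in
/-- The membership rule of the «`coker φ_T` locally free of rank `k`» sub-subfunctor in the currency of
★ `LocallyFreeRankLocusRepresentable`. [cite: StacksProject, Tag 05P8] -/
theorem mem_iff_forall_fittingIdealSheaf_pullback_cokernel {T : Scheme.{u}} (g : P.toFunctor.obj (op T)) :
    g ∈ Q.obj (op T) ↔ ∀ j < k, fittingIdealSheaf ((Scheme.Modules.pullback (g : T ⟶ S)).obj (cokernel φ))
      ((IsAffineLocalizing.cokernel φ hE hF).pullback _)
      ((IsAffineFiniteType.cokernel φ hE hF hFf).pullback _ (IsAffineLocalizing.cokernel φ hE hF)) j = ⊥ := by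
  rw [hQ]
  refine forall₂_congr fun j _ => ?_
  rw [fittingIdealSheaf_cokernel_map_pullback φ hE hF hFf]

-- Stacks 05P8 (3) for `coker φ`: the sub-subfunctor `Q` («`coker φ_T` finite locally free of rank `k`») is
-- represented by a scheme whose classifying morphism is an IMMERSION — ★ `exists_iso_yoneda_immersion_rankEq` /
-- ★ `isImmersion_of_rankEq` applied with the two translations `mem_iff_fittingIdealSheaf_pullback_cokernel` and
-- `mem_iff_forall_fittingIdealSheaf_pullback_cokernel` as `hP`, `hQ` (not restated — dedup).

omit hP in
/-- **The «`coker φ_T` locally free of rank `k`» sub-subfunctor exists** inside `P`. [cite: StacksProject, Tag 05P8] -/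
theorem exists_subfunctor_cokerRankEq :
    ∃ Q : Subfunctor P.toFunctor, ∀ {T : Scheme.{u}} (g : P.toFunctor.obj (op T)), g ∈ Q.obj (op T) ↔
      ∀ j < k, fittingIdealSheaf (cokernel ((Scheme.Modules.pullback (g : T ⟶ S)).map φ))
        (isAffineLocalizing_cokernel_map_pullback φ hE hF _) (isAffineFiniteType_cokernel_map_pullback φ hE hF hFf _)
        j = ⊥ := by
  obtain ⟨Q, hQ'⟩ := exists_subfunctor_rankEq (IsAffineLocalizing.cokernel φ hE hF)
    (IsAffineFiniteType.cokernel φ hE hF hFf) k P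
  refine ⟨Q, fun g => ?_⟩
  rw [hQ']
  refine forall₂_congr fun j _ => ?_
  rw [fittingIdealSheaf_cokernel_map_pullback φ hE hF hFf]

end Loci

end Literature.AlgebraicGeometry.Modules

end
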